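import Literature.NumberTheory.Automorphic.TentKernel

/-!
# The dyadic majorisation of a Selberg transform by squares of tent transforms
(Iwaniec, *Spectral Methods of Automorphic Forms*, GSM 53, proof of Theorem 7.4 / (12.5): the
continuous and tempered spectrum is estimated dyadically through the local Weyl law, Prop. 7.2,
(7.10)–(7.11), and partial summation against a decreasing majorant `H` of `|h|`; PDF pp. 71–76, 126)

A brick of the Eisenstein-free proof of the pretrace estimate (12.5)
(`Literature.NumberTheory.Automorphic.Iwaniec2002_eq_12_5`). Pure real analysis: for a test kernel
`k` with a majorant `H` of `|h_k|` on `[0, ∞)`, antitone on `[0, ∞)` with `(t+1) H(t)` integrable,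

1. (§1) `H ≥ 0`, the decay `H(2T) T² ≤ ∫_0^∞ (t+1) H`, and the **dyadic sum bound**
   `Σ_{m ≤ M} 4^m H(a_m) ≤ 16 (H(0) + ∫_0^∞ (t+1) H)` for the left end points `a_0 = 0`,
   `a_m = 2^{m-1}` of the dyadic pieces `[a_m, 2^m]` (`sum_dyadic_le`);
2. (§2) the **symbol inequality**: with `δ_m = (128 · 2^m)⁻²` and `c_m = H(a_m)/(π δ_m)²`,
   for every real `t` and `|s| ≤ 1`,
   `s · h_k(t) - Σ_{m ≤ M} c_m h_{δ_m}(t)² ≤ H(2^M)` (`symbol_le`), where `h_{δ}` is the transform of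
   the tent kernel of `TentKernel` (`h_δ(t)² ≥ (πδ)²` on `|t| ≤ 2^m` for `δ = δ_m`).

Everything here is proved; nothing is vendored; no fact is introduced.

## References
* [Iwaniec2002] H. Iwaniec, *Spectral Methods of Automorphic Forms*, 2nd ed., GSM 53, AMS 2002,
  Prop. 7.2 and proofs of Thm 7.4 & (12.5), PDF pp. 71–76, 126
  (held copy `book:iwaniec2002-spectral-methods-automorphic-forms`).
-/

noncomputable section

namespace Literature.NumberTheory.Automorphic

open _root_.MeasureTheory _root_.Set _root_.Filter _root_.Real
open scoped _root_.Topology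

/-! ## 1. The majorant `H` -/

section Majorant

variable {k : ℝ → ℝ} {H : ℝ → ℝ}

/-- The left end points of the dyadic pieces `[a_0, 2^0] = [0, 1]`, `[a_m, 2^m] = [2^{m-1}, 2^m]`. [folklore] -/
def dyadicLeft (m : ℕ) : ℝ := if m = 0 then 0 else 2 ^ (m - 1)

/-- `a_0 = 0`. [folklore] -/
theorem dyadicLeft_zero : dyadicLeft 0 = 0 := if_pos rfl

/-- `a_{m+1} = 2^m`. [folklore] -/
theorem dyadicLeft_succ (m : ℕ) : dyadicLeft (m + 1) = 2 ^ m := by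
  simp [dyadicLeft]

/-- `a_m ≥ 0`. [folklore] -/
theorem dyadicLeft_nonneg (m : ℕ) : 0 ≤ dyadicLeft m := by
  unfold dyadicLeft; split_ifs <;> positivity

/-- `a_m ≤ 2^m`. [folklore] -/
theorem dyadicLeft_le_pow (m : ℕ) : dyadicLeft m ≤ 2 ^ m := by
  unfold dyadicLeft
  split_ifs with h
  · positivity
  · exact pow_le_pow_right₀ (by norm_num) (Nat.sub_le m 1)

/-- `H ≥ 0` on `[0, ∞)` (it majorises `|h|`). [folklore] -/
theorem majorant_nonneg (hHh : ∀ t : ℝ, 0 ≤ t → ‖selbergTransform k t‖ ≤ H t) {t : ℝ} (ht : 0 ≤ t) : 0 ≤ H t :=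
  (norm_nonneg _).trans (hHh t ht)

/-- **Decay of the majorant**: `H(2T) T² ≤ ∫_0^∞ (t+1) H(t) dt` for `T > 0` (the integrand is at least
`T · H(2T)` on `(T, 2T]`). [folklore] -/
theorem majorant_mul_sq_le (hH : AntitoneOn H (Ici 0)) (hHh : ∀ t : ℝ, 0 ≤ t → ‖selbergTransform k t‖ ≤ H t)
    (hI : IntegrableOn (fun t => (t + 1) * H t) (Ioi 0)) {T : ℝ} (hT : 0 < T) :
    H (2 * T) * T ^ 2 ≤ ∫ t in Ioi 0, (t + 1) * H t := by
  have h0 : ∀ t, 0 < t → 0 ≤ (t + 1) * H t := fun t ht => mul_nonneg (by linarith) (majorant_nonneg hHh ht.le)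
  have hsub : Ioc T (2 * T) ⊆ Ioi 0 := fun t ht => lt_trans hT ht.1
  calc H (2 * T) * T ^ 2 = ∫ _ in Ioc T (2 * T), T * H (2 * T) := by
        rw [setIntegral_const, Measure.real, Real.volume_Ioc, ENNReal.toReal_ofReal (by linarith), smul_eq_mul]
        ring
    _ ≤ ∫ t in Ioc T (2 * T), (t + 1) * H t := by
        refine setIntegral_mono_on (integrableOn_const measure_Ioc_lt_top.ne) (hI.mono_set hsub) measurableSet_Ioc
          fun t ht => ?_
        have h1 : T ≤ t + 1 := by linarith [ht.1]
        have h2 : H (2 * T) ≤ H t := hH (show (0 : ℝ) ≤ t by exact (lt_trans hT ht.1).le)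
          (show (0 : ℝ) ≤ 2 * T by linarith) ht.2
        exact mul_le_mul h1 h2 (majorant_nonneg hHh (by linarith)) (by linarith [ht.1])
    _ ≤ ∫ t in Ioi 0, (t + 1) * H t :=
        setIntegral_mono_set hI ((ae_restrict_iff' measurableSet_Ioi).mpr (Eventually.of_forall h0))
          (Eventually.of_forall hsub)

/-- The partial integrals `J(n) = ∫_{(0, 2^n]} (t+1) H` increase by at least `4^n H(2^{n+1})`. [folklore] -/
theorem dyadic_increment_le (hH : AntitoneOn H (Ici 0)) (hHh : ∀ t : ℝ, 0 ≤ t → ‖selbergTransform k t‖ ≤ H t)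
    (hI : IntegrableOn (fun t => (t + 1) * H t) (Ioi 0)) (n : ℕ) :
    4 ^ n * H (2 ^ (n + 1)) ≤ (∫ t in Ioc 0 ((2 : ℝ) ^ (n + 1)), (t + 1) * H t) - ∫ t in Ioc 0 ((2 : ℝ) ^ n), (t + 1) * H t := by
  have hpos : (0 : ℝ) < 2 ^ n := by positivity
  have hsplit : Ioc 0 ((2 : ℝ) ^ (n + 1)) = Ioc 0 ((2 : ℝ) ^ n) ∪ Ioc ((2 : ℝ) ^ n) (2 ^ (n + 1)) :=
    (Ioc_union_Ioc_eq_Ioc hpos.le (pow_le_pow_right₀ (by norm_num) (Nat.le_succ n))).symm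
  have hsub1 : Ioc 0 ((2 : ℝ) ^ n) ⊆ Ioi 0 := fun t ht => ht.1
  have hsub2 : Ioc ((2 : ℝ) ^ n) (2 ^ (n + 1)) ⊆ Ioi 0 := fun t ht => lt_trans hpos ht.1
  rw [hsplit, setIntegral_union (Ioc_disjoint_Ioc_of_le le_rfl) measurableSet_Ioc (hI.mono_set hsub1) (hI.mono_set hsub2),
    add_sub_cancel_left]
  have h4 : (4 : ℝ) ^ n = 2 ^ n * 2 ^ n := by rw [← mul_pow]; norm_num
  calc 4 ^ n * H (2 ^ (n + 1)) = ∫ _ in Ioc ((2 : ℝ) ^ n) (2 ^ (n + 1)), 2 ^ n * H (2 ^ (n + 1)) := by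
        rw [setIntegral_const, Measure.real, Real.volume_Ioc, pow_succ, ENNReal.toReal_ofReal (by linarith), smul_eq_mul,
          h4]
        ring
    _ ≤ ∫ t in Ioc ((2 : ℝ) ^ n) (2 ^ (n + 1)), (t + 1) * H t := by
        refine setIntegral_mono_on (integrableOn_const measure_Ioc_lt_top.ne) (hI.mono_set hsub2) measurableSet_Ioc
          fun t ht => ?_
        have h1 : (2 : ℝ) ^ n ≤ t + 1 := by linarith [ht.1]
        have h2 : H (2 ^ (n + 1)) ≤ H t :=
          hH (show (0 : ℝ) ≤ t from (lt_trans hpos ht.1).le) (show (0 : ℝ) ≤ 2 ^ (n + 1) by positivity) ht.2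
        exact mul_le_mul h1 h2 (majorant_nonneg hHh (by positivity)) (by linarith [ht.1])

/-- **The dyadic sum bound**: `Σ_{m ≤ M} 4^m H(a_m) ≤ 16 (H(0) + ∫_0^∞ (t+1) H)`. [cite: Iwaniec2002, proof of Thm 7.4 & (12.5) (partial summation), PDF pp. 75–76, 126] -/
theorem sum_dyadic_le (hH : AntitoneOn H (Ici 0)) (hHh : ∀ t : ℝ, 0 ≤ t → ‖selbergTransform k t‖ ≤ H t)
    (hI : IntegrableOn (fun t => (t + 1) * H t) (Ioi 0)) (M : ℕ) :
    ∑ m ∈ Finset.range (M + 1), (4 : ℝ) ^ m * H (dyadicLeft m) ≤ 16 * (H 0 + ∫ t in Ioi 0, (t + 1) * H t) := by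
  set I : ℝ := ∫ t in Ioi 0, (t + 1) * H t with hIdef
  set J : ℕ → ℝ := fun n => ∫ t in Ioc 0 ((2 : ℝ) ^ n), (t + 1) * H t with hJ
  have h0 : ∀ t, 0 < t → 0 ≤ (t + 1) * H t := fun t ht => mul_nonneg (by linarith) (majorant_nonneg hHh ht.le)
  have hH0 : 0 ≤ H 0 := majorant_nonneg hHh le_rfl
  have hI0 : 0 ≤ I := setIntegral_nonneg measurableSet_Ioi fun t ht => h0 t ht
  have hJI : ∀ n, J n ≤ I := fun n =>
    setIntegral_mono_set hI ((ae_restrict_iff' measurableSet_Ioi).mpr (Eventually.of_forall h0))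
      (Eventually.of_forall fun t ht => ht.1)
  have hJ0 : ∀ n, 0 ≤ J n := fun n => setIntegral_nonneg measurableSet_Ioc fun t ht => h0 t ht.1
  -- the terms `m ≥ 2`, telescoping
  have htail : ∀ L : ℕ, ∑ n ∈ Finset.range L, (4 : ℝ) ^ (n + 2) * H (dyadicLeft (n + 2)) ≤ 16 * I := by
    intro L
    have h1 : ∀ n ∈ Finset.range L, (4 : ℝ) ^ (n + 2) * H (dyadicLeft (n + 2)) ≤ 16 * (J (n + 1) - J n) := by
      intro n _
      rw [show n + 2 = (n + 1) + 1 from rfl, dyadicLeft_succ, pow_succ, pow_succ]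
      have := dyadic_increment_le hH hHh hI n
      nlinarith
    calc ∑ n ∈ Finset.range L, (4 : ℝ) ^ (n + 2) * H (dyadicLeft (n + 2))
        ≤ ∑ n ∈ Finset.range L, 16 * (J (n + 1) - J n) := Finset.sum_le_sum h1
      _ = 16 * (J L - J 0) := by rw [← Finset.mul_sum, Finset.sum_range_sub]
      _ ≤ 16 * I := by nlinarith [hJI L, hJ0 0]
  -- assemble
  rcases Nat.lt_or_ge M 1 with hM | hM
  · have : M = 0 := by omega
    subst this
    simp [dyadicLeft_zero]
    nlinarith
  rcases Nat.lt_or_ge M 2 with hM2 | hM2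
  · have : M = 1 := by omega
    subst this
    rw [Finset.sum_range_succ, Finset.sum_range_succ, Finset.sum_range_zero, dyadicLeft_zero,
      show dyadicLeft 1 = 1 by simp [dyadicLeft]]
    have h1 : H 1 ≤ H 0 := hH (by simp) (by simp) (by norm_num)
    nlinarith
  · obtain ⟨L, rfl⟩ : ∃ L, M = L + 2 := ⟨M - 2, by omega⟩
    rw [show L + 2 + 1 = (L + 1) + 2 from rfl, Finset.sum_range_add _ (L + 1) 2]
    -- wait: `sum_range_add` splits `range (a + b)` as `range a` plus shifted `range b`; we want the
    -- first two terms separate, so use the split `2 + (L + 1)` instead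
    rw [← Finset.sum_range_add _ (L + 1) 2, show (L + 1) + 2 = 2 + (L + 1) by ring, Finset.sum_range_add _ 2 (L + 1)]
    rw [Finset.sum_range_succ, Finset.sum_range_succ, Finset.sum_range_zero, dyadicLeft_zero,
      show dyadicLeft 1 = 1 by simp [dyadicLeft]]
    have h1 : H 1 ≤ H 0 := hH (by simp) (by simp) (by norm_num)
    have h2 := htail (L + 1)
    have h3 : ∑ x ∈ Finset.range (L + 1), (4 : ℝ) ^ (2 + x) * H (dyadicLeft (2 + x)) =
        ∑ n ∈ Finset.range (L + 1), (4 : ℝ) ^ (n + 2) * H (dyadicLeft (n + 2)) :=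
      Finset.sum_congr rfl fun n _ => by rw [add_comm 2 n]
    rw [h3]
    nlinarith

end Majorant

/-! ## 2. The symbol inequality -/

section Symbol

variable {k : ℝ → ℝ} {H : ℝ → ℝ}

/-- The radii `δ_m = (128 · 2^m)⁻²` of the tent kernels attached to the dyadic pieces. [folklore] -/
def dyadicDelta (m : ℕ) : ℝ := ((128 * (2 : ℝ) ^ m) ^ 2)⁻¹

/-- `δ_m > 0`. [folklore] -/
theorem dyadicDelta_pos (m : ℕ) : 0 < dyadicDelta m := by unfold dyadicDelta; positivity

/-- `δ_m ≤ 1/64`. [folklore] -/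
theorem dyadicDelta_le (m : ℕ) : dyadicDelta m ≤ 1 / 64 := by
  unfold dyadicDelta
  rw [inv_le_comm₀ (by positivity) (by norm_num)]
  have : (1 : ℝ) ≤ 2 ^ m := one_le_pow₀ (by norm_num)
  nlinarith

/-- `δ_m ≤ 1`. [folklore] -/
theorem dyadicDelta_le_one (m : ℕ) : dyadicDelta m ≤ 1 := (dyadicDelta_le m).trans (by norm_num)

/-- `4^m δ_m = 128⁻²`: `δ_m⁻¹ = 128² 4^m`. [folklore] -/
theorem inv_dyadicDelta (m : ℕ) : (dyadicDelta m)⁻¹ = 128 ^ 2 * 4 ^ m := by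
  unfold dyadicDelta
  rw [inv_inv, mul_pow, ← pow_mul, show (2 : ℝ) ^ (m * 2) = 4 ^ m by rw [pow_mul']; norm_num]

/-- The coefficients `c_m = H(a_m)/(π δ_m)²`. [folklore] -/
def dyadicCoeff (H : ℝ → ℝ) (m : ℕ) : ℝ := H (dyadicLeft m) / (π * dyadicDelta m) ^ 2

/-- `c_m ≥ 0`. [folklore] -/
theorem dyadicCoeff_nonneg (hHh : ∀ t : ℝ, 0 ≤ t → ‖selbergTransform k t‖ ≤ H t) (m : ℕ) : 0 ≤ dyadicCoeff H m :=
  div_nonneg (majorant_nonneg hHh (dyadicLeft_nonneg m)) (sq_nonneg _)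

/-- On the `m`-th dyadic piece the `m`-th tent transform is large: for `0 ≤ t ≤ 2^m`,
`(π δ_m)² ≤ h_{δ_m}(t)²`. [cite: Iwaniec2002, proof of Prop. 7.2, PDF p. 73] -/
theorem sq_tent_ge_on_piece (m : ℕ) {t : ℝ} (ht0 : 0 ≤ t) (ht : t ≤ 2 ^ m) :
    (π * dyadicDelta m) ^ 2 ≤ (selbergTransform (tentKernel (dyadicDelta m)) t).re ^ 2 :=
  sq_selbergTransform_tentKernel_ge (dyadicDelta_pos m) (dyadicDelta_le m) t
    (smallness_of_le (one_le_pow₀ (by norm_num)) ht0 ht)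

/-- Every `0 ≤ t ≤ 2^M` lies in a dyadic piece `[a_m, 2^m]` with `m ≤ M`. [folklore] -/
theorem exists_piece {M : ℕ} {t : ℝ} (ht0 : 0 ≤ t) (ht : t ≤ 2 ^ M) :
    ∃ m, m ≤ M ∧ dyadicLeft m ≤ t ∧ t ≤ 2 ^ m := by
  classical
  have hex : ∃ m, t ≤ (2 : ℝ) ^ m := ⟨M, ht⟩
  refine ⟨Nat.find hex, Nat.find_min' hex ht, ?_, Nat.find_spec hex⟩
  rcases Nat.eq_zero_or_pos (Nat.find hex) with h0 | hpos
  · rw [h0, dyadicLeft_zero]; exact ht0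
  · have hlt : ¬ t ≤ (2 : ℝ) ^ (Nat.find hex - 1) := Nat.find_min hex (Nat.sub_lt hpos Nat.one_pos)
    unfold dyadicLeft
    rw [if_neg (Nat.pos_iff_ne_zero.mp hpos)]
    exact (not_le.mp hlt).le

/-- **The symbol inequality**: for every real `t`, `|s| ≤ 1` and `M`,
`s h_k(t) - Σ_{m ≤ M} c_m h_{δ_m}(t)² ≤ H(2^M)`. [cite: Iwaniec2002, proof of Thm 7.4 & (12.5), PDF pp. 75–76, 126] -/
theorem symbol_le (hH : AntitoneOn H (Ici 0)) (hHh : ∀ t : ℝ, 0 ≤ t → ‖selbergTransform k t‖ ≤ H t)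
    {s : ℝ} (hs : |s| ≤ 1) (M : ℕ) (t : ℝ) :
    s * (selbergTransform k t).re -
        ∑ m ∈ Finset.range (M + 1), dyadicCoeff H m * (selbergTransform (tentKernel (dyadicDelta m)) t).re ^ 2 ≤
      H (2 ^ M) := by
  -- reduce to `t ≥ 0`
  wlog ht0 : 0 ≤ t generalizing t with hmain
  · have h := hmain (-t) (by linarith)
    have e : ∀ k' : ℝ → ℝ, selbergTransform k' ((-t : ℝ) : ℂ) = selbergTransform k' t := fun k' => by
      rw [Complex.ofReal_neg, selbergTransform_neg]
    simp only [e] at h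
    exact h
  have hst : s * (selbergTransform k t).re ≤ H t := by
    have h1 : s * (selbergTransform k t).re ≤ |(selbergTransform k t).re| := by
      have := abs_mul s (selbergTransform k t).re
      have h2 : |s| * |(selbergTransform k t).re| ≤ 1 * |(selbergTransform k t).re| :=
        mul_le_mul_of_nonneg_right hs (abs_nonneg _)
      linarith [le_abs_self (s * (selbergTransform k t).re)]
    exact h1.trans ((Complex.abs_re_le_norm _).trans (hHh t ht0))
  have hsum0 : ∀ m, 0 ≤ dyadicCoeff H m * (selbergTransform (tentKernel (dyadicDelta m)) t).re ^ 2 :=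
    fun m => mul_nonneg (dyadicCoeff_nonneg hHh m) (sq_nonneg _)
  by_cases ht : t ≤ 2 ^ M
  · obtain ⟨m, hmM, hml, hmr⟩ := exists_piece ht0 ht
    have h1 : H t ≤ H (dyadicLeft m) := hH (dyadicLeft_nonneg m) ht0 hml
    have h2 : H (dyadicLeft m) ≤ dyadicCoeff H m * (selbergTransform (tentKernel (dyadicDelta m)) t).re ^ 2 := by
      have hpos : 0 < (π * dyadicDelta m) ^ 2 := by have := dyadicDelta_pos m; positivity
      unfold dyadicCoeff
      rw [div_mul_eq_mul_div, le_div_iff₀ hpos]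
      exact mul_le_mul_of_nonneg_left (sq_tent_ge_on_piece m ht0 hmr) (majorant_nonneg hHh (dyadicLeft_nonneg m))
    have h3 : dyadicCoeff H m * (selbergTransform (tentKernel (dyadicDelta m)) t).re ^ 2 ≤
        ∑ m ∈ Finset.range (M + 1), dyadicCoeff H m * (selbergTransform (tentKernel (dyadicDelta m)) t).re ^ 2 :=
      Finset.single_le_sum (fun m _ => hsum0 m) (Finset.mem_range.mpr (Nat.lt_succ_of_le hmM))
    have h4 : 0 ≤ H (2 ^ M) := majorant_nonneg hHh (by positivity)
    linarith
  · push Not at ht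
    have h1 : H t ≤ H (2 ^ M) := hH (show (0 : ℝ) ≤ 2 ^ M by positivity) ht0 ht.le
    have h2 : 0 ≤ ∑ m ∈ Finset.range (M + 1), dyadicCoeff H m * (selbergTransform (tentKernel (dyadicDelta m)) t).re ^ 2 :=
      Finset.sum_nonneg fun m _ => hsum0 m
    linarith

end Symbol

end Literature.NumberTheory.Automorphic

end
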